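import Literature.MathematicalPhysics.QuantumFieldTheory.QuasiLocalGaugePerturbation
import Literature.MathematicalPhysics.QuantumLattice.GrassmannIntegral

/-!
# `SeaFactorisationBridge` (crux stmt-QuantumFields-13880) — negative-side support: the admissible cone
# of `RobustYangMills` is sup-small, and the sea is not a perturbed Wilson measure

Standing-disprover extraction (cdisprove cycle 1); re-creation in the tree, with credit, of the formal
obstruction first written by refuter rattack-13902 (`D1SeaObstruction.lean` §2, gate-box evidence of
the item, 2026-08-15T23:02Z).  Over the D1 vocabulary `QuasiLocalGaugePerturbation` only.

* `abs_total_sub_total_le` — in the cone `NormLE κ η`, `κ ≥ 0`, the TOTAL perturbation oscillates by at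
  most `2η · #blocks` over all pairs of configurations (`O(η)` per physical block `ℓ₀⁴`, `→ 0` per site),
  whereas the sea's effective action `−Σ_f log|det D_W|` oscillates by `O(1)` per site: the sea is outside
  the cone by `(ℓ₀/a_k)⁴ → ∞` before renormalisation.
* `signedWeight_ne_boltzmann`, `quenchedWeight_ne_boltzmann` — given one negative-sign (resp. one
  zero-mode) configuration, the signed (resp. phase-quenched) fermionic weight is not `c · e^{−β′S_W−W}`
  for any perturbation `W`, coupling `β′` and constant `c`: the hypothesis `RobustYangMills` cannot be
  instantiated on the sea through its measures `μ_{β′,W}`.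
-/

noncomputable section

namespace Summit.QuantumFields.QCD.Theorems.SeaFactorisationBridge.Negative

open Finset Literature.MathematicalPhysics.QuantumFieldTheory Literature.MathematicalPhysics.QuantumLattice

variable {S b : ℕ} [NeZero S]

/-- An activity on the empty polymer depends on no link: it is a constant. [folklore] -/
theorem act_empty_const (W : QuasiLocalGaugePerturbation 4 S (Matrix.specialUnitaryGroup (Fin 3) ℂ) b) (U V : GaugeConfig 4 S (Matrix.specialUnitaryGroup (Fin 3) ℂ)) :
    W.act ∅ U = W.act ∅ V :=
  W.dependsOn ∅ (fun e he => by simp at he)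

/-- **Double counting**: summing the weighted sums over all block corners counts every non-empty polymer
at least once, `∑_{X ≠ ∅} ‖W_X‖_∞ ≤ ∑_y ∑_{X ∋ y} ‖W_X‖_∞ e^{κ|X|}` (`κ ≥ 0`). [folklore] -/
theorem sum_supNorm_le_sum_weightedSum (W : QuasiLocalGaugePerturbation 4 S (Matrix.specialUnitaryGroup (Fin 3) ℂ) b) {κ : ℝ}
    (hκ : 0 ≤ κ) :
    ∑ X ∈ (polymers b).filter (fun X => X.Nonempty), W.supNorm X ≤
      ∑ y ∈ blockCorners (d := 4) (L := S) b, W.weightedSum κ y := by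
  classical
  have hR : ∑ y ∈ blockCorners (d := 4) (L := S) b, W.weightedSum κ y =
      ∑ X ∈ polymers b, ∑ y ∈ blockCorners (d := 4) (L := S) b,
        (if y ∈ X then W.supNorm X * Real.exp (κ * X.card) else 0) := by
    simp only [QuasiLocalGaugePerturbation.weightedSum, polymersThrough, Finset.sum_filter]
    exact Finset.sum_comm
  rw [hR, Finset.sum_filter]
  refine Finset.sum_le_sum fun X hX => ?_
  split_ifs with hne
  · obtain ⟨y, hy⟩ := hne
    have hyC : y ∈ blockCorners (d := 4) (L := S) b := mem_polymers_iff.1 hX hy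
    have h1 : W.supNorm X ≤ W.supNorm X * Real.exp (κ * X.card) := by
      have : (1 : ℝ) ≤ Real.exp (κ * X.card) := Real.one_le_exp (by positivity)
      nlinarith [W.supNorm_nonneg X]
    refine h1.trans ?_
    rw [← Finset.sum_filter]
    exact Finset.single_le_sum (f := fun _ => W.supNorm X * Real.exp (κ * X.card))
      (fun _ _ => mul_nonneg (W.supNorm_nonneg X) (Real.exp_pos _).le) (Finset.mem_filter.2 ⟨hyC, hy⟩)
  · exact Finset.sum_nonneg fun _ _ => by
      split_ifs
      · exact mul_nonneg (W.supNorm_nonneg X) (Real.exp_pos _).le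
      · exact le_rfl

/-- **The admissible cone is sup-small**: `NormLE κ η` with `κ ≥ 0` gives
`|W(U) − W(V)| ≤ 2η · #blocks` for all configurations `U, V`. [folklore] -/
theorem abs_total_sub_total_le (W : QuasiLocalGaugePerturbation 4 S (Matrix.specialUnitaryGroup (Fin 3) ℂ) b) {κ η : ℝ} (hκ : 0 ≤ κ)
    (h : W.NormLE κ η) (U V : GaugeConfig 4 S (Matrix.specialUnitaryGroup (Fin 3) ℂ)) :
    |W.total U - W.total V| ≤ 2 * η * (blockCorners (d := 4) (L := S) b).card := by
  classical
  have hsplit : W.total U - W.total V =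
      ∑ X ∈ (polymers b).filter (fun X => X.Nonempty), (W.act X U - W.act X V) := by
    rw [QuasiLocalGaugePerturbation.total, QuasiLocalGaugePerturbation.total, ← Finset.sum_sub_distrib,
      Finset.sum_filter]
    refine Finset.sum_congr rfl fun X _ => ?_
    split_ifs with hne
    · rfl
    · rw [Finset.not_nonempty_iff_eq_empty.1 hne, act_empty_const W U V, sub_self]
  rw [hsplit]
  calc |∑ X ∈ (polymers b).filter (fun X => X.Nonempty), (W.act X U - W.act X V)|
      ≤ ∑ X ∈ (polymers b).filter (fun X => X.Nonempty), |W.act X U - W.act X V| :=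
        Finset.abs_sum_le_sum_abs _ _
    _ ≤ ∑ X ∈ (polymers b).filter (fun X => X.Nonempty), 2 * W.supNorm X := by
        refine Finset.sum_le_sum fun X _ => ?_
        calc |W.act X U - W.act X V| ≤ |W.act X U| + |W.act X V| := abs_sub _ _
          _ ≤ W.supNorm X + W.supNorm X :=
            add_le_add (W.abs_act_le_supNorm X U) (W.abs_act_le_supNorm X V)
          _ = 2 * W.supNorm X := by ring
    _ = 2 * ∑ X ∈ (polymers b).filter (fun X => X.Nonempty), W.supNorm X := by rw [Finset.mul_sum]
    _ ≤ 2 * ∑ y ∈ blockCorners (d := 4) (L := S) b, W.weightedSum κ y := by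
        have := sum_supNorm_le_sum_weightedSum W hκ
        linarith
    _ ≤ 2 * ∑ _y ∈ blockCorners (d := 4) (L := S) b, η := by
        have := Finset.sum_le_sum fun y (hy : y ∈ blockCorners (d := 4) (L := S) b) => h y hy
        linarith
    _ = 2 * η * (blockCorners (d := 4) (L := S) b).card := by
        rw [Finset.sum_const, nsmul_eq_mul]; ring

/-- **Every perturbed Boltzmann weight is positive**, for every perturbation and coupling. [folklore] -/
theorem perturbedDensity_pos (W : QuasiLocalGaugePerturbation 4 S (Matrix.specialUnitaryGroup (Fin 3) ℂ) b) (β' : ℝ) (U : GaugeConfig 4 S (Matrix.specialUnitaryGroup (Fin 3) ℂ)) :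
    0 < Real.exp (-β' * wilsonAction (fundamentalRep (Fin 3)) U - W.total U) :=
  Real.exp_pos _

/-- **The signed sea is never a perturbed Wilson weight**: one configuration with negative
`Re ∏_f det D_W(U, m_f)` excludes `c · e^{−β′S_W − W}` for all `W`, `β′` and `c ≥ 0`. [folklore] -/
theorem signedWeight_ne_boltzmann {Nf : ℕ} (mq : Fin Nf → ℝ)
    (hneg : ∃ U₀ : GaugeConfig 4 S (Matrix.specialUnitaryGroup (Fin 3) ℂ),
      (∏ f, fermionDet (wilsonDirac (fundamentalRep (Fin 3)) U₀ (mq f) 1)).re < 0)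
    (W : QuasiLocalGaugePerturbation 4 S (Matrix.specialUnitaryGroup (Fin 3) ℂ) b) (β' c : ℝ) (hc : 0 ≤ c) :
    (fun U : GaugeConfig 4 S (Matrix.specialUnitaryGroup (Fin 3) ℂ) => (∏ f, fermionDet (wilsonDirac (fundamentalRep (Fin 3)) U (mq f) 1)).re) ≠
      fun U => c * Real.exp (-β' * wilsonAction (fundamentalRep (Fin 3)) U - W.total U) := by
  obtain ⟨U₀, hU₀⟩ := hneg
  intro h
  have h0 := congrFun h U₀
  have : 0 ≤ c * Real.exp (-β' * wilsonAction (fundamentalRep (Fin 3)) U₀ - W.total U₀) :=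
    mul_nonneg hc (Real.exp_pos _).le
  linarith

/-- **Nor is the phase-quenched sea**: one configuration with an exact zero mode at one bare mass, plus
one configuration where no determinant vanishes, exclude `∏_f ‖det D_W(U, m_f)‖ = c · e^{−β′S_W − W}` for
all `W`, `β′`, `c`. [folklore] -/
theorem quenchedWeight_ne_boltzmann {Nf : ℕ} (mq : Fin Nf → ℝ)
    (hzero : ∃ (U₀ : GaugeConfig 4 S (Matrix.specialUnitaryGroup (Fin 3) ℂ)) (f : Fin Nf),
      fermionDet (wilsonDirac (fundamentalRep (Fin 3)) U₀ (mq f) 1) = 0)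
    (hpos : ∃ U₁ : GaugeConfig 4 S (Matrix.specialUnitaryGroup (Fin 3) ℂ), ∀ f,
      fermionDet (wilsonDirac (fundamentalRep (Fin 3)) U₁ (mq f) 1) ≠ 0)
    (W : QuasiLocalGaugePerturbation 4 S (Matrix.specialUnitaryGroup (Fin 3) ℂ) b) (β' c : ℝ) :
    (fun U : GaugeConfig 4 S (Matrix.specialUnitaryGroup (Fin 3) ℂ) => ∏ f, ‖fermionDet (wilsonDirac (fundamentalRep (Fin 3)) U (mq f) 1)‖) ≠
      fun U => c * Real.exp (-β' * wilsonAction (fundamentalRep (Fin 3)) U - W.total U) := by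
  obtain ⟨U₀, f₀, hU₀⟩ := hzero
  obtain ⟨U₁, hU₁⟩ := hpos
  intro h
  have h0 := congrFun h U₀
  have h1 := congrFun h U₁
  have hz : ∏ f, ‖fermionDet (wilsonDirac (fundamentalRep (Fin 3)) U₀ (mq f) 1)‖ = 0 :=
    Finset.prod_eq_zero (Finset.mem_univ f₀) (by rw [hU₀, norm_zero])
  rw [hz] at h0
  have hc : c = 0 := by
    have hexp := Real.exp_pos (-β' * wilsonAction (fundamentalRep (Fin 3)) U₀ - W.total U₀)
    rcases mul_eq_zero.1 h0.symm with hc | hexp0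
    · exact hc
    · exact absurd hexp0 hexp.ne'
  rw [hc, zero_mul] at h1
  have : 0 < ∏ f, ‖fermionDet (wilsonDirac (fundamentalRep (Fin 3)) U₁ (mq f) 1)‖ :=
    Finset.prod_pos fun f _ => norm_pos_iff.2 (hU₁ f)
  linarith

end Summit.QuantumFields.QCD.Theorems.SeaFactorisationBridge.Negative

end
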